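import Summits.BirchSwinnertonDyer.BirchSwinnertonDyer.Theorems.PrintCf2RamifiedOffTYZMonskyRedeiForm
import HarnessLib

/-!
# Route `PrintCf2`, crux stmt-BirchSwinnertonDyer-20509 `RamifiedOffTYZOfFacts` — the left kernel of `A` versus the right kernel of the REAL
# Rédei matrix `N = A + D₋₁` (cell `bsd-print-cf2`, LEAD of 20509 g5, line `offtyz-v7`, cycle 6; sequel of `…MonskyRedeiForm` (p676494);
# Theses-free, fact-free, no `def`)

HONEST FRAMING: pure 𝔽₂ linear algebra about the tree's `HeathBrown1994.legendreMatrix` / `legendreDiagonal`; nothing about `E_n` or BSD is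
asserted.  It is the kernel step behind the Ω-FORM of the Q-form identity (★) (LEAD note `Cruxes/RamifiedOffTYZOfFacts/Lines/offtyz_v7_QForm.md`
§11; typed `QForm.QFormIdentityOmega`): on a block with an even number of primes `≡ 3 (mod 4)` the corank-one left null vector `u` of Monsky's `A`
together with its sign twist `(c₋₁·u)·𝟙` is the right null vector of the real Rédei matrix `N`, and at the level of KERNEL SUMS
  `Σ_{uᵀA = 0} (u + (c₋₁·u)·𝟙) = Σ_{N u = 0} u`
(`transpose_mulVec_eq_zero_iff`: `Aᵀu = 0 ⟺ Nu = (c·u)c` from the transpose law `Aᵀ = N + ccᵀ`; `realRedei_mulVec_one`: `N𝟙 = c`; the map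
`u ↦ u + (c·u)𝟙` is then an involutive bijection between the two kernels: `sum_leftKer_twist_eq_sum_ker_realRedei`).  So the
`x_{−1}x_{p_i}`-coefficients of the genus-point invariant `Q_n` are sums of right null vectors of REAL Rédei matrices of the blocks `d ≡ 5 (8)`.
BSD is not proved by any of this; no class is closed by this file.

References: [cite: HeathBrown1994SelmerCongruentII, Appendix (Monsky), typescript p. 39 L13–L26]; tree p676494 (`legendreMatrix_transpose`,
`legendreMatrix_mulVec_one`, `vec_add_eq_zero_iff`).
-/

namespace Summit.BirchSwinnertonDyer.PrintCf2.MonskyRedeiForm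

open Finset Matrix Literature.NumberTheory.EllipticCurves.HeathBrown1994

variable {k : ℕ} (p : Fin k → ℕ)
variable (hp : ∀ i, (p i).Prime) (hp2 : ∀ i, p i ≠ 2) (hinj : Function.Injective p)

/-! ## The collapse to the REAL Rédei kernel: `Σ_{uᵀA = 0} (u + (c·u)𝟙) = Σ_{N u = 0} u`

The Ω-form of the Q-form identity (LEAD note `Lines/offtyz_v7_QForm.md` §11, typed as `QForm.QFormIdentityOmega`): for a block with an
EVEN number of primes `≡ 3 (mod 4)` the left null data of `A` (plus the sign twist) is the right kernel sum of the real Rédei matrix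
`N = A + D₋₁`.  Pure 𝔽₂ linear algebra from §1–§2: the bijection `u ↦ u + (c·u)·𝟙` between `{u : Aᵀu = 0}` and `{u : N u = 0}`. -/

include hp hp2 hinj in
/-- **`Aᵀ u = 0 ⟺ N u = (c·u)·c`** (`N = A + D₋₁`, `c = c₋₁`), from the transpose law `Aᵀ = N + c cᵀ`.
[cite: HeathBrown1994SelmerCongruentII, Appendix (Monsky), typescript p. 39 L13–L26] -/
theorem transpose_mulVec_eq_zero_iff (u : Fin k → ZMod 2) :
    (legendreMatrix p)ᵀ *ᵥ u = 0 ↔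
      (legendreMatrix p + legendreDiagonal p (-1)) *ᵥ u =
        ((fun i => addLegendreSym (-1) (p i)) ⬝ᵥ u) • (fun i => addLegendreSym (-1) (p i)) := by
  rw [legendreMatrix_transpose p hp hp2 hinj, add_mulVec]
  have hcc : (Matrix.of fun i j => addLegendreSym (-1) (p i) * addLegendreSym (-1) (p j)) *ᵥ u =
      ((fun i => addLegendreSym (-1) (p i)) ⬝ᵥ u) • (fun i => addLegendreSym (-1) (p i)) := by
    funext i
    simp only [mulVec, dotProduct, Matrix.of_apply, Pi.smul_apply, smul_eq_mul]
    rw [Finset.sum_mul]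
    refine Finset.sum_congr rfl fun j _ => ?_
    ring
  rw [hcc, vec_add_eq_zero_iff]

/-- **`N 𝟙 = c₋₁`** always: `N𝟙 = A𝟙 + D₋₁𝟙 = c₋₁`.
[cite: HeathBrown1994SelmerCongruentII, Appendix (Monsky), typescript p. 39 L13–L26] -/
theorem realRedei_mulVec_one :
    (legendreMatrix p + legendreDiagonal p (-1)) *ᵥ (fun _ => (1 : ZMod 2)) = fun i => addLegendreSym (-1) (p i) := by
  rw [add_mulVec, legendreMatrix_mulVec_one, zero_add]
  funext i
  unfold legendreDiagonal
  rw [mulVec_diagonal, mul_one]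

include hp hp2 hinj in
/-- **The collapse `Σ_{uᵀA = 0} (u + (c·u)·𝟙) = Σ_{N u = 0} u`** for a block with `c·𝟙 = 0` (an even number of primes `≡ 3 (mod 4)`,
e.g. every block `d ≡ 1 (mod 4)`): the map `u ↦ u + (c·u)·𝟙` is a bijection from the left kernel of `A` onto the right kernel of the real
Rédei matrix `N = A + D₋₁` (`N(u + (c·u)𝟙) = (c·u)c + (c·u)c = 0`; it is an involution since `c·(u + (c·u)𝟙) = c·u`), and it carries the
summand `u + (c·u)𝟙` to `u′`.  This is the identity behind the Ω-form of the Q-form conjecture (★) (`QForm.QFormIdentityOmega`):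
the `x_{−1}x_{p_i}`-coefficients of the genus-point invariant are the right null vectors of REAL Rédei matrices. [folklore] -/
theorem sum_leftKer_twist_eq_sum_ker_realRedei (hc : (∑ i, addLegendreSym (-1) (p i)) = 0) :
    (∑ u ∈ (Finset.univ : Finset (Fin k → ZMod 2)).filter (fun u => (legendreMatrix p)ᵀ *ᵥ u = 0),
        (u + ((fun i => addLegendreSym (-1) (p i)) ⬝ᵥ u) • (fun _ => (1 : ZMod 2)))) =
      ∑ u ∈ (Finset.univ : Finset (Fin k → ZMod 2)).filter
        (fun u => (legendreMatrix p + legendreDiagonal p (-1)) *ᵥ u = 0), u := by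
  set c : Fin k → ZMod 2 := fun i => addLegendreSym (-1) (p i) with hcdef
  set N := legendreMatrix p + legendreDiagonal p (-1) with hNdef
  -- the twist map and its basic identities
  have hc1 : c ⬝ᵥ (fun _ => (1 : ZMod 2)) = 0 := by
    simp only [dotProduct, mul_one]; exact hc
  have htwist_dot : ∀ u : Fin k → ZMod 2, c ⬝ᵥ (u + (c ⬝ᵥ u) • (fun _ => (1 : ZMod 2))) = c ⬝ᵥ u := by
    intro u
    rw [dotProduct_add, dotProduct_smul, hc1, smul_zero, add_zero]
  have hvv : ∀ w : Fin k → ZMod 2, w + w = 0 := fun w => funext fun i => CharTwo.add_self_eq_zero (w i)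
  have hinvol : ∀ u : Fin k → ZMod 2,
      (u + (c ⬝ᵥ u) • (fun _ => (1 : ZMod 2))) + (c ⬝ᵥ (u + (c ⬝ᵥ u) • (fun _ => (1 : ZMod 2)))) •
        (fun _ => (1 : ZMod 2)) = u := by
    intro u
    rw [htwist_dot, add_assoc, hvv, add_zero]
  have hN1 : N *ᵥ (fun _ => (1 : ZMod 2)) = c := realRedei_mulVec_one p
  -- membership transport
  have hmem : ∀ u : Fin k → ZMod 2, (legendreMatrix p)ᵀ *ᵥ u = 0 ↔
      N *ᵥ (u + (c ⬝ᵥ u) • (fun _ => (1 : ZMod 2))) = 0 := by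
    intro u
    rw [transpose_mulVec_eq_zero_iff p hp hp2 hinj u, ← hNdef, ← hcdef, mulVec_add, mulVec_smul, hN1]
    constructor
    · intro h; rw [h, hvv]
    · intro h
      rw [← vec_add_eq_zero_iff]
      exact h
  refine Finset.sum_nbij' (fun u => u + (c ⬝ᵥ u) • (fun _ => (1 : ZMod 2)))
    (fun u => u + (c ⬝ᵥ u) • (fun _ => (1 : ZMod 2))) ?_ ?_ ?_ ?_ ?_
  · intro u hu
    rw [Finset.mem_filter] at hu ⊢
    exact ⟨Finset.mem_univ _, (hmem u).mp hu.2⟩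
  · intro u hu
    rw [Finset.mem_filter] at hu ⊢
    refine ⟨Finset.mem_univ _, ?_⟩
    rw [hmem, hinvol]
    exact hu.2
  · intro u _; exact hinvol u
  · intro u _; exact hinvol u
  · intro u _; rfl

end Summit.BirchSwinnertonDyer.PrintCf2.MonskyRedeiForm
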